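import Summits.ResolutionOfSingularities.ResolutionOfSingularities.Theorems.HilbertSamuelEliminationSigmaMaxModificationsCorridor3WLadderSegmentsTower
import Summits.ResolutionOfSingularities.ResolutionOfSingularities.Theorems.HilbertSamuelEliminationSigmaMaxModificationsCorridor3WLadderStrataScope
import Literature.AlgebraicGeometry.Resolution.ComponentGluing
import Literature.AlgebraicGeometry.Resolution.BlowupChartMembership
import HarnessLib

/-!
# [OURS · L1 W4.2] REPLAY DISCIPLINE along `S(X, ν)`: pending replay centres lie over NON-ISOLATED points, hence a step that blows up a
# marked point ISOLATED in its stratum is a WHOLE-PART step (never a replayed lower-dimensional centre)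
# (crux `SigmaMaxModifications` stmt-ResolutionOfSingularities-18506; conjunct `SigmaMaxModificationsCorridor3` stmt-…-19249; line `w_ladder`;
# RECOGNITION (R5) = (H-emp), first half)

Stub worker res-L1-w42-stub-1 (gen 4). Helper file `--supports stmt-ResolutionOfSingularities-19249 --as helper`; kernel only, FACT-FREE, no new
definition (the invariant is spelled inline).

CJS Rem. 6.29 (1) replays, inside `X_n`, the canonical resolution sequence of the treated label part `T = Y_r^{(j)}`; for an ADMISSIBLE oracle its
centres lie over the non-regular locus of `T` (`OracleAdmissible`: `CentresOver (regularLocus T)ᶜ`). The tree's cycle invariant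
(`Helpers.CycleInv`) does not remember this. We carry the weaker, self-propagating form

  «every centre still to be replayed lies over a NON-ISOLATED point of the replayed stage»
  (`Q.rest.CentresOver {z | ¬ IsOpen {z}}` for the pending state `Q`),

which holds at a cycle start because an isolated point of the REDUCED scheme `T` is a regular point
(`isRegularLocalRing_stalk_of_isOpen_singleton`: its local ring is a reduced zero-dimensional local ring, a field), and propagates along the
replayed blow-ups because a blow-up creates no isolated point over its centre (`isOpen_singleton_base_of_isOpen_singleton`: the exceptional
divisor is an effective Cartier divisor, so an isolated point of `Bl_D(S)` lies off it, where the blow-down is a local isomorphism).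

CONSEQUENCE (`pending_eq_none_of_isBlownUp_of_stratumIsolated`, chain form `Seg.P_succ_eq_none_of_isBlownUp_of_iso`): if the marked point `x_n`
is isolated in `X_n(ν)` and is blown up by the canonical step, that step is NOT a replay step `φ_* D` (its centre would contain an isolated point of
the replayed stage), so it is the blow-up of a whole label part and the next stage is BETWEEN CYCLES (`P_{n+1} = none`). This is the base case of
the label discipline of (H-emp) (companion file `…SegmentsHEmp`).

OURS bookkeeping; NOT a statement of the manuscript [Hironaka2017] nor of [CossartJannsenSaito2020]. AI-written; AI review is weaker than expert
review.

References: V. Cossart, U. Jannsen, S. Saito, LNM 2270 (2020), Rem. 6.29 (1), Def. 6.38, p. 107 [CossartJannsenSaito2020]; U. Görtz,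
T. Wedhorn, *Algebraic Geometry I*, Prop. 13.91 (3) (a blow-up is an isomorphism off its centre; the exceptional divisor is effective Cartier)
[GortzWedhorn2020].
-/

noncomputable section

set_option linter.dupNamespace false -- namespace `…Corridor3.Moving` re-enters `…Corridor3` (module convention of the Moving files)

open CategoryTheory AlgebraicGeometry TopologicalSpace Topology IsLocalRing
open Literature.AlgebraicGeometry.Resolution Literature.RingTheory.HilbertSamuel
open Literature.AlgebraicGeometry.CossartJannsenSaito2020
open Summit.ResolutionOfSingularities.ResolutionOfSingularities.Theorems.CampaignW42
open Summit.ResolutionOfSingularities.ResolutionOfSingularities.Theorems.SigmaMaxModificationsCorridor3.Helpers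

namespace Summit.ResolutionOfSingularities.ResolutionOfSingularities.Theorems.SigmaMaxModificationsCorridor3.Moving.Seg

universe u

/-! ## §1. Isolated points: the primes of the stalk, regularity on reduced schemes, and blow-ups -/

/-- At a point `y` which is OPEN in `Y` (an isolated point) every prime ideal of `𝒪_{Y,y}` is the maximal ideal: the primes of the stalk are
the generizations of `y` (Stacks 01J7), and an open point has none but itself. [folklore] -/
theorem ideal_eq_maximalIdeal_of_isOpen_singleton {Y : Scheme.{u}} {y : Y} (hy : IsOpen ({y} : Set Y))
    (J : Ideal (Y.presheaf.stalk y)) [hJ : J.IsPrime] : J = maximalIdeal (Y.presheaf.stalk y) := by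
  let q : PrimeSpectrum (Y.presheaf.stalk y) := ⟨J, hJ⟩
  have hsp : (Y.fromSpecStalk y).base q ⤳ y := by
    have hmem : (Y.fromSpecStalk y).base q ∈ Set.range (Y.fromSpecStalk y).base := ⟨q, rfl⟩
    rw [Scheme.range_fromSpecStalk] at hmem
    exact hmem
  have heq : (Y.fromSpecStalk y).base q = y := hsp.mem_open hy (Set.mem_singleton y)
  have hcl : (Y.fromSpecStalk y).base (closedPoint (Y.presheaf.stalk y)) = y := Scheme.fromSpecStalk_closedPoint
  have hq : q = closedPoint (Y.presheaf.stalk y) := (Y.fromSpecStalk y).isEmbedding.injective (heq.trans hcl.symm)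
  exact congrArg PrimeSpectrum.asIdeal hq

/-- At an isolated point every element of the maximal ideal of the stalk is nilpotent. [folklore] -/
theorem isNilpotent_of_mem_maximalIdeal_of_isOpen_singleton {Y : Scheme.{u}} {y : Y} (hy : IsOpen ({y} : Set Y))
    {t : Y.presheaf.stalk y} (ht : t ∈ maximalIdeal (Y.presheaf.stalk y)) : IsNilpotent t := by
  rw [nilpotent_iff_mem_prime]
  intro J hJ
  rw [ideal_eq_maximalIdeal_of_isOpen_singleton hy J]
  exact ht

/-- **An isolated point of a REDUCED scheme is a regular point**: its local ring is a reduced local ring whose maximal ideal consists of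
nilpotents, i.e. a field. (Used for the treated parts `T = Y_n^{(j)}`, which carry their reduced structure.) [folklore] -/
theorem isRegularLocalRing_stalk_of_isOpen_singleton {Y : Scheme.{u}} [IsReduced Y] {y : Y} (hy : IsOpen ({y} : Set Y)) :
    IsRegularLocalRing (Y.presheaf.stalk y) := by
  have hbot : maximalIdeal (Y.presheaf.stalk y) = ⊥ := by
    refine le_bot_iff.mp fun t ht => ?_
    exact (isNilpotent_of_mem_maximalIdeal_of_isOpen_singleton hy ht).eq_zero
  have hF : IsField (Y.presheaf.stalk y) := (IsLocalRing.isField_iff_maximalIdeal_eq).mpr hbot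
  letI := hF.toField
  infer_instance

/-- Hence an isolated point of a reduced scheme lies in the regular locus. [folklore] -/
theorem mem_regularLocus_of_isOpen_singleton {Y : Scheme.{u}} [IsReduced Y] {y : Y} (hy : IsOpen ({y} : Set Y)) :
    y ∈ Scheme.regularLocus Y :=
  isRegularLocalRing_stalk_of_isOpen_singleton hy

/-- **A blow-up creates no isolated point over its centre**: if `z'` is an isolated point of a blow-up `X' = Bl_I(X)`, then `π(z')` is an
isolated point of `X`. Indeed `z'` lies off the exceptional divisor `π⁻¹ V(I)` — an effective Cartier divisor, cut out in `𝒪_{X',z'}` by a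
non-zero-divisor, which at an isolated point would be nilpotent — and off the centre `π` is an isomorphism (GW Prop. 13.91 (3)), in particular
an open map. [cite: GortzWedhorn2020, Prop. 13.91 (3)] -/
theorem isOpen_singleton_base_of_isOpen_singleton {X' X : Scheme.{u}} {π : X' ⟶ X} {I : X.IdealSheafData} (hπ : IsBlowup π I)
    {z' : X'} (hz' : IsOpen ({z'} : Set X')) : IsOpen ({π.base z'} : Set X) := by
  -- `z'` is not on the exceptional divisor
  have hnot : π.base z' ∉ (I.support : Set X) := by
    intro hmem
    have hmem' : z' ∈ ((I.comap π).support : Set X') := by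
      rw [Scheme.IdealSheafData.support_comap]; exact hmem
    obtain ⟨t, ht, hspan⟩ := hπ.isEffectiveCartier.exists_stalkIdeal_eq_span z'
    have hle := (mem_support_iff_stalkIdeal_le (I.comap π) z').mp hmem'
    rw [hspan, Ideal.span_singleton_le_iff_mem] at hle
    obtain ⟨n, hn⟩ := isNilpotent_of_mem_maximalIdeal_of_isOpen_singleton hz' hle
    have h0 : (0 : X'.presheaf.stalk z') ∈ nonZeroDivisors (X'.presheaf.stalk z') := hn ▸ pow_mem ht n
    exact nonZeroDivisors.ne_zero h0 rfl
  -- off the centre `π` restricts to an isomorphism, so `(π⁻¹ U).ι ≫ π` is an open immersion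
  let U : X.Opens := ⟨(I.support : Set X)ᶜ, I.support.isClosed.isOpen_compl⟩
  haveI : IsIso (π ∣_ U) := hπ.isIso_compl
  have hoi : IsOpenImmersion ((π ⁻¹ᵁ U).ι ≫ π) := by
    rw [← morphismRestrict_ι]; infer_instance
  have hzU : z' ∈ π ⁻¹ᵁ U := hnot
  -- the image of the open set `ι⁻¹ {z'}` under the open immersion is `{π z'}`
  have heq : ((π ⁻¹ᵁ U).ι ≫ π).base '' ((π ⁻¹ᵁ U).ι.base ⁻¹' {z'}) = {π.base z'} := by
    ext y
    constructor
    · rintro ⟨w, hw, rfl⟩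
      have hw' : (π ⁻¹ᵁ U).ι.base w = z' := hw
      show ((π ⁻¹ᵁ U).ι ≫ π).base w ∈ ({π.base z'} : Set X)
      rw [Scheme.Hom.comp_apply, hw']
      rfl
    · rintro rfl
      have hz'r : z' ∈ Set.range (π ⁻¹ᵁ U).ι.base := by rw [Scheme.Opens.range_ι]; exact hzU
      obtain ⟨w, hw⟩ := hz'r
      refine ⟨w, ?_, ?_⟩
      · show (π ⁻¹ᵁ U).ι.base w ∈ ({z'} : Set X'); rw [hw]; rfl
      · show ((π ⁻¹ᵁ U).ι ≫ π).base w = π.base z'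
        rw [Scheme.Hom.comp_apply, hw]
  rw [← heq]
  exact hoi.base_open.isOpenMap _ (hz'.preimage (π ⁻¹ᵁ U).ι.base.hom.continuous)

/-- Contrapositive, set form: the preimage under a blow-down of the NON-isolated points consists of non-isolated points. [folklore] -/
theorem preimage_nonIsolated_subset {X' X : Scheme.{u}} {π : X' ⟶ X} {I : X.IdealSheafData} (hπ : IsBlowup π I) :
    π.base ⁻¹' {z : X | ¬ IsOpen ({z} : Set X)} ⊆ {z' : X' | ¬ IsOpen ({z'} : Set X')} :=
  fun _ hz' hopen => hz' (isOpen_singleton_base_of_isOpen_singleton hπ hopen)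

/-- On a reduced scheme the non-regular locus consists of non-isolated points. [folklore] -/
theorem compl_regularLocus_subset_nonIsolated (Y : Scheme.{u}) [IsReduced Y] :
    (Scheme.regularLocus Y)ᶜ ⊆ {y : Y | ¬ IsOpen ({y} : Set Y)} :=
  fun _ hy hopen => hy (mem_regularLocus_of_isOpen_singleton hopen)

/-! ## §2. The invariant «pending replay centres lie over non-isolated points» along canonical near steps -/

section Invariant

variable {R : ∀ S : Scheme.{u}, CentreSeq S → Prop} {N : ℕ} {ν : ℕ → ℕ}

/-- **ONE CANONICAL STEP PRESERVES THE INVARIANT** (admissible oracle): if every centre still to be replayed at `(X_n, L, P)` lies over a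
non-isolated point of the replayed stage, the same holds at the next state `P'` of any canonical step. At a cycle start the oracle's centres
lie over the non-regular locus of the (reduced) treated part, whose isolated points are regular; inside a cycle the first pending centre is
consumed and the rest is read one blow-up higher, where no new isolated point appears over the centre.
[cite: CossartJannsenSaito2020, Rem. 6.29 (1)] -/
theorem replayOverNonIsolated_step (hRa : OracleAdmissible R) {W : Scheme.{u}} {L : Labelling W} {P : Option (Pending W)}
    (hP : ∀ Q, P = some Q → Q.rest.CentresOver {z : Q.src | ¬ IsOpen ({z} : Set Q.src)})
    {C : W.IdealSheafData} {P' : Option (Pending (blowup C))} (hst : IsCanonicalStep R N ν L P C P') :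
    ∀ Q', P' = some Q' → Q'.rest.CentresOver {z : Q'.src | ¬ IsOpen ({z} : Set Q'.src)} := by
  -- the replay lemma: a cons-replay step from a list over non-isolated points yields a list over non-isolated points
  have replay : ∀ (j : ℕ) {S : Scheme.{u}} (φ : S ⟶ W) (D : S.IdealSheafData) (t' : CentreSeq (blowup D)),
      t'.CentresOver ((blowup.π D).base ⁻¹' {z : S | ¬ IsOpen ({z} : Set S)}) →
      IsReplayStep L (Scheme.hsStratum W N ν) j φ (CentreSeq.cons D t') C P' →
      ∀ Q', P' = some Q' → Q'.rest.CentresOver {z : Q'.src | ¬ IsOpen ({z} : Set Q'.src)} := by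
    intro j S φ D t' ht' hs Q' hQ'
    obtain ⟨-, φ', hφ', -, hP'⟩ := hs
    obtain rfl : Q' = ⟨j, blowup D, φ', hφ', t'⟩ := Option.some_injective _ (hQ'.symm.trans hP')
    exact CentreSeq.CentresOver.mono t' (preimage_nonIsolated_subset (blowup.isBlowup D)) ht'
  intro Q' hQ'
  cases P with
  | none =>
    obtain ⟨j, -, hcl, t, hRt, hs⟩ := hst
    cases t with
    | nil _ =>
      obtain ⟨-, rfl⟩ := hs
      exact absurd hQ' (by simp)
    | cons D t' =>
      haveI : IsReduced (Scheme.IdealSheafData.vanishingIdeal ⟨L.part (Scheme.hsStratum W N ν) j, hcl⟩).subscheme :=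
        ComponentGluing.isReduced_subscheme_vanishingIdeal _
      have hover := (hRa _ _ hRt).2.1
      rw [CentreSeq.centresOver_cons] at hover
      refine replay j _ D t' ?_ hs Q' hQ'
      exact CentreSeq.CentresOver.mono t' (Set.preimage_mono (compl_regularLocus_subset_nonIsolated _)) hover.2
  | some Q =>
    obtain ⟨-, hs⟩ := hst
    have hQ := hP Q rfl
    revert hs hQ
    cases Q.rest with
    | nil _ =>
      intro hs _
      obtain ⟨-, rfl⟩ := hs
      exact absurd hQ' (by simp)
    | cons D t' =>
      intro hs hQ
      rw [CentreSeq.centresOver_cons] at hQ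
      exact replay Q.lbl Q.hom D t' hQ.2 hs Q' hQ'

/-- The invariant along a canonical near step of marked stages. [cite: CossartJannsenSaito2020, Rem. 6.29 (1)] -/
theorem replayOverNonIsolated_nearStep (hRa : OracleAdmissible R) {s s' : MarkedStage.{u}} (hst : CanonicalNearStep R N ν s s')
    (hP : ∀ Q, s.P = some Q → Q.rest.CentresOver {z : Q.src | ¬ IsOpen ({z} : Set Q.src)}) :
    ∀ Q, s'.P = some Q → Q.rest.CentresOver {z : Q.src | ¬ IsOpen ({z} : Set Q.src)} := by
  obtain ⟨C, P', hln, x', hcs, -, -, -, rfl⟩ := hst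
  exact replayOverNonIsolated_step hRa hP hcs

/-- The invariant along `Reaches`. [folklore] -/
theorem replayOverNonIsolated_of_reaches (hRa : OracleAdmissible R) {s₀ s : MarkedStage.{u}} (hr : Reaches R N ν s₀ s)
    (hP : ∀ Q, s₀.P = some Q → Q.rest.CentresOver {z : Q.src | ¬ IsOpen ({z} : Set Q.src)}) :
    ∀ Q, s.P = some Q → Q.rest.CentresOver {z : Q.src | ¬ IsOpen ({z} : Set Q.src)} := by
  induction hr with
  | refl => exact hP
  | tail _ hst ih => exact replayOverNonIsolated_nearStep hRa hst ih

/-- **The invariant holds at every stage reached from an initial marked stage** (no cycle begun there). [folklore] -/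
theorem replayOverNonIsolated_of_reaches_init (hRa : OracleAdmissible R) {X : Scheme.{u}} [IsLocallyNoetherian X] {x : X}
    {s : MarkedStage.{u}} (hr : Reaches R N ν (MarkedStage.init X x) s) :
    ∀ Q, s.P = some Q → Q.rest.CentresOver {z : Q.src | ¬ IsOpen ({z} : Set Q.src)} :=
  replayOverNonIsolated_of_reaches hRa hr fun Q hQ => absurd hQ (by simp [MarkedStage.init])

/-! ## §3. A step blowing up a marked point isolated in its stratum is a whole-part step -/

/-- A closed immersion `φ : S → W` with image inside `Y`, a point `x ∈ U` with `U` open and `U ∩ Y ⊆ {x}` (so `x` is isolated in `Y`),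
and a set `D ⊆ S` of NON-isolated points of `S`: then `x ∉ φ(D)` — the `φ`-preimage of `x` would be the open point `φ⁻¹(U)` of `S`.
[folklore] -/
theorem not_mem_image_of_isolated_of_subset_nonIsolated {S W : Scheme.{u}} (φ : S ⟶ W) [IsClosedImmersion φ] {Y : Set W}
    (hrange : Set.range φ.base ⊆ Y) {U : Set W} (hUo : IsOpen U) {x : W} (hxU : x ∈ U) (hUiso : U ∩ Y ⊆ {x})
    {D : Set S} (hD : D ⊆ {z : S | ¬ IsOpen ({z} : Set S)}) : x ∉ φ.base '' D := by
  rintro ⟨d, hd, hdx⟩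
  refine hD hd ?_
  have : ({d} : Set S) = φ.base ⁻¹' U := by
    ext w
    simp only [Set.mem_singleton_iff, Set.mem_preimage]
    constructor
    · rintro rfl; rw [hdx]; exact hxU
    · intro hw
      have : φ.base w = x := hUiso ⟨hw, hrange ⟨w, rfl⟩⟩
      exact φ.isEmbedding.injective (this.trans hdx.symm)
  rw [this]
  exact hUo.preimage φ.base.hom.continuous

/-- **THE STEP AT A BLOWN-UP, STRATUM-ISOLATED MARKED POINT IS NOT A REPLAY STEP.** Admissible oracle; if the replayed subscheme of the pending
state lies in the stratum (the cycle invariant: it IS the treated part), the pending centres lie over non-isolated points (§2), the marked point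
`x_n` is isolated in `X_n(ν)` and lies in the centre `C` of the canonical step, then the step blows up a whole label part (a cycle start with empty
oracle answer, or a cycle end) and the next stage is BETWEEN CYCLES: `P' = none`. [cite: CossartJannsenSaito2020, Rem. 6.29 (1), Def. 6.38] -/
theorem pending_eq_none_of_mem_support_of_stratumIsolated (hRa : OracleAdmissible R) {s : MarkedStage.{u}}
    (hrange : ∀ Q, s.P = some Q → Set.range Q.hom.base ⊆ Scheme.hsStratum s.W N ν)
    (hP : ∀ Q, s.P = some Q → Q.rest.CentresOver {z : Q.src | ¬ IsOpen ({z} : Set Q.src)})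
    (hU : ∃ U : Set s.W, IsOpen U ∧ s.pt ∈ U ∧ U ∩ Scheme.hsStratum s.W N ν ⊆ {s.pt})
    {C : s.W.IdealSheafData} {P' : Option (Pending (blowup C))} (hst : IsCanonicalStep R N ν s.L s.P C P')
    (hx : s.pt ∈ (C.support : Set s.W)) : P' = none := by
  obtain ⟨U, hUo, hxU, hUiso⟩ := hU
  rcases hsP : s.P with _ | Q
  · -- between cycles: a cons-start would put `x_n` in `φ_* D` with `D` over the non-regular locus of the REDUCED part `T`, whose points
    -- are non-isolated; but the `φ`-preimage of `x_n` is an isolated point of `T`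
    rw [hsP] at hst
    obtain ⟨j, -, hcl, t, hRt, hs⟩ := hst
    cases t with
    | nil _ => exact hs.2
    | cons D t' =>
      exfalso
      haveI : IsReduced (Scheme.IdealSheafData.vanishingIdeal ⟨s.L.part (Scheme.hsStratum s.W N ν) j, hcl⟩).subscheme :=
        ComponentGluing.isReduced_subscheme_vanishingIdeal _
      obtain ⟨hC, -⟩ := hs
      rw [hC, coe_support_map_of_isClosedImmersion] at hx
      have hover := (hRa _ _ hRt).2.1
      rw [CentreSeq.centresOver_cons] at hover
      have hrangeT : Set.range (Scheme.IdealSheafData.vanishingIdeal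
          ⟨s.L.part (Scheme.hsStratum s.W N ν) j, hcl⟩).subschemeι.base ⊆ Scheme.hsStratum s.W N ν := by
        rw [Scheme.IdealSheafData.range_subschemeι, Scheme.IdealSheafData.coe_support_vanishingIdeal]
        exact s.L.part_subset _ _
      exact not_mem_image_of_isolated_of_subset_nonIsolated _ hrangeT hUo hxU hUiso
        (hover.1.trans (compl_regularLocus_subset_nonIsolated _)) hx
  · -- inside a cycle: a cons-replay step would put `x_n = φ(d)` with `d` on a pending centre, non-isolated by §2
    rw [hsP] at hst
    obtain ⟨-, hs⟩ := hst
    haveI := Q.isClosedImmersion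
    have hQover := hP Q hsP
    have hQrange := hrange Q hsP
    revert hs hQover
    cases Q.rest with
    | nil _ => intro hs _; exact hs.2
    | cons D t' =>
      intro hs hQover
      exfalso
      obtain ⟨hC, -⟩ := hs
      rw [hC, coe_support_map_of_isClosedImmersion] at hx
      rw [CentreSeq.centresOver_cons] at hQover
      exact not_mem_image_of_isolated_of_subset_nonIsolated Q.hom hQrange hUo hxU hUiso hQover.1 hx

end Invariant

/-! ## §4. Chain form: after a blown-up ISOLATED stage of a chain from a maximal origin, the next stage is between cycles -/

section Chain

variable {R : ∀ S : Scheme.{u}, CentreSeq S → Prop} {N : ℕ} {ν : ℕ → ℕ} {k : Type u} [Field k]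
  {c : ℕ → MarkedStage.{u}} (hc : ∀ n, CanonicalNearStep R N ν (c n) (c (n + 1))) (hRf : OracleFunctional R) (hRa : OracleAdmissible R)
  (hν : ν ≠ iterPSum N Phi)
  {p : ℕ} {X : Scheme.{u}} [IsLocallyNoetherian X] {x : X} (hX : IsMaximalOrigin p N ν X x)
  (hreach : Reaches R N ν (MarkedStage.init X x) (c 0))

include hc hRa hreach in
/-- Along a chain from a maximal origin, every pending replay centre lies over a non-isolated point of the replayed stage. [folklore] -/
theorem replayOverNonIsolated_chain (n : ℕ) :
    ∀ Q, (c n).P = some Q → Q.rest.CentresOver {z : Q.src | ¬ IsOpen ({z} : Set Q.src)} :=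
  replayOverNonIsolated_of_reaches_init hRa (reaches_chain hreach hc n)

include hc hRf hRa hν hX hreach in
/-- **AFTER A BLOWN-UP STAGE WHOSE MARKED POINT IS ISOLATED IN THE HILBERT–SAMUEL LOCUS, THE CHAIN IS BETWEEN CYCLES**: `(c (b+1)).P = none`.
(The unit based at `b` starts with the blow-up of a whole label part containing `x_b` — locally the point `x_b`, CJS Def. 6.38 (ii) — and no
lower-dimensional replay is pending over it.) [cite: CossartJannsenSaito2020, Def. 6.38, Rem. 6.29 (1)] -/
theorem P_succ_eq_none_of_isBlownUp_of_iso (b : ℕ) (hb : (c b).IsBlownUp R N ν) (hiso : Iso N (c b)) : (c (b + 1)).P = none := by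
  obtain ⟨k', _, hcyc⟩ := exists_cycleInv_chain hRa hν hX hreach hc
  obtain ⟨k'', _, _, hg⟩ := hX.exists_stateGood_of_reaches hRa hν (reaches_chain hreach hc b)
  have hU := stratumIsolated_of_iso hg hiso
  obtain ⟨C, P', hln, x', hcs, -, -, -, hsucc⟩ := hc b
  obtain ⟨C₁, P₁, hcs₁, hx₁⟩ := hb
  obtain rfl : C₁ = C := hcs₁.centre_unique hRf hcs
  have hrange : ∀ Q, (c b).P = some Q → Set.range Q.hom.base ⊆ Scheme.hsStratum (c b).W N ν :=
    fun Q hQ => ((hcyc b).pending Q hQ).1.le.trans ((c b).L.part_subset _ _)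
  have hP' : P' = none :=
    pending_eq_none_of_mem_support_of_stratumIsolated hRa hrange (replayOverNonIsolated_chain hc hRa hreach b) hU hcs hx₁
  rw [hsucc, hP']

end Chain

end Summit.ResolutionOfSingularities.ResolutionOfSingularities.Theorems.SigmaMaxModificationsCorridor3.Moving.Seg

end
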